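/-
Copyright (c) 2026 the pub-hodgecm-mathlib formalisation cell (harness21).  Prover seat hodgecm-mathlib-LH4-p15 (g2), req620 Track A «(D-RAM) FOUR-FRAME» squad
(STAGE-1b, row (2) of the piece `f_{T₊}`, the (β₂) road (R-36) «PURE-CELL LEDGER»; β₂ sub-dealer LH4-p04 (g10) WORD #24 letter ‹TERM.letter.v2› 78b8538f5e7a241e, holder LH4-p15 (g2)): the fibration letters,
2026-09-05.
-/
import Summits.HodgeConjecture.HodgeConjecture.Theorems.F0P3cDyRamTerminalCellSocketLetters   -- ★ p864310 (this seat, T-b5b): LIT letters, fibre dictionary, flips; brings ★ p864206, ★ p16 sphere transport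
import Summits.HodgeConjecture.HodgeConjecture.Theorems.F0P3cDyRamSphereCellGenerator         -- ★ p863952 (this seat, T-b1): generator independence on the sphere
import Summits.HodgeConjecture.HodgeConjecture.Theorems.F0P3cDyRamAffineLabelDepthZero        -- ★ p864020 (this seat, T-b2a): `v_le_one_of_fixed_of_mul_exp_le`
import Summits.HodgeConjecture.HodgeConjecture.Theorems.F0P3cDyRamRowCellSocketReads          -- ★ p863914 (LH4-p16 (g2)): `exists_coord_of_gen`
import Summits.HodgeConjecture.HodgeConjecture.Theorems.F0P3cDyRamRowCleanCellBit             -- ★ (LH4-p06 (g9)): brings ★ ConeLevelTransport (`exists_coneData_of_gen`, glue fibre count), ‹OFF› vocabulary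
import Literature.NumberTheory.LocalFields.WildQuadraticDatumTraceBound                        -- ★ Lit: `trace_bound_pow_of_isRamifiedQuadraticDatum`
import HarnessLib

/-!
# Crux `H413`, line LH4 «(D-RAM) FOUR-FRAME» — STAGE-1b, row (2), the (β₂) road (R-36), (ROW-TERM): «THE TERMINAL CELL'S FIBRATION LETTERS» — the socket letters (hI) and (hF) of
# LH4-p19 (g2)'s ★ p863833 on the terminal cell `(j, b)` in the block's letters, and the glued vertex over every weighted member (parts of the proof of ‹TERM.letter.v2›,
# ★ `…F0P3cDyRamTermHolds.term_holds`, split out per declaration)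

Cell `hodgecm-mathlib` (D-0151), FLOOR 0, crux item H413 = `stmt-HodgeConjecture-24833`, route of record `HCCMUnconditional`; squad F0∕P3c∕LH4; lane
`--supports stmt-HodgeConjecture-24833 --as helper` (count-neutral; pays NO tier-0 row).  THEOREMS ONLY (no `def`, no instance, no notation, no `sorry`, default heartbeats);
★-only imports; states NO law; (β₂) stays a HYPOTHESIS.  Letters = those of ‹TERM.letter.v2›'s block after
`d = 2` plus the terminal cell's constants (reference pair `κ₀, ξ₀` at the radius, `δ = 2δ₂`, the digit system `R_d`) — exactly the `have`s of ★ `term_holds`'s preamble, as hypotheses.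
* `cls_iff_and_digit_sub_le_of_gens` — (hI): ★ p863952 at `τ₀ = |ϖE|^(j+1)`, `η = |ϖE|³`, the digit bound upgraded to `|ϖ|⁴` by the parity of `σ`-fixed valuations.
* `ncard_fibre_eq_of_lits` — (hF): ★ T-b5b §1, §4 + LH4-p16 (g2)'s ★ `ncard_fibre_eq_ncard_fibre_of_sphere`, `LIT :≡` «on the sphere and realisable from a vertex».
* `exists_glued_of_weight_ne_zero` — ★ `exists_coneData_of_gen` + ★ `ncard_glueFibre_eq_natCard_normFibre_of_gen` + the weight letter `hf`.
HONEST LABEL.  Count-neutral; nothing printed is asserted; no census law is stated; `HC_CM` is proved only modulo the 7 printed citations (2 remaining named inputs: hLiu418 =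
`stmt-HodgeConjecture-24832`, h413 = `stmt-HodgeConjecture-24833`) until rung 0 closes.
## References
* [Kottwitz1986BaseChangeUnits] R. E. Kottwitz, *Base change for unit elements of Hecke algebras*, Compositio Math. 60 (1986): §1 pp. 240–241, §3.
* [Rogawski1990] J. D. Rogawski, *Automorphic Representations of Unitary Groups in Three Variables*, Ann. of Math. Stud. 123 (1990): §4.9 Prop. 4.9.1 (b) p. 55.
* [Jacobowitz1962] R. Jacobowitz, *Hermitian forms over local fields*, Amer. J. Math. 84 (1962): §4.
* [Serre1979] J.-P. Serre, *Local Fields*, GTM 67 (1979): Ch. III §6 Prop. 12; Ch. V §3 Cor. 3 pp. 84–86; Ch. XV §2.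
* [Flicker1998UnitaryFL] Y. Z. Flicker, *Elementary proof of the fundamental lemma for a unitary group*, Canad. J. Math. 50 (1998): Prop. 7 p. 84.
-/

set_option autoImplicit false

noncomputable section

namespace Summit.HodgeConjecture.HodgeConjecture.Cruxes.H413.F0P3cDyRamTerminalCellFibres

open scoped Matrix MatrixGroups Classical Valued WithZero
open WithZero
open Literature.NumberTheory.Automorphic Literature.NumberTheory.Automorphic.UnitaryThreeFourFrame Literature.NumberTheory.Automorphic.UnitaryLatticeTree
open Literature.NumberTheory.Automorphic.HermitianLattice Literature.NumberTheory.Automorphic.EllipticPlaneAsFieldLine Literature.NumberTheory.LocalFields.QuadraticOrder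
open Literature.NumberTheory.Rogawski1990
open Literature.NumberTheory.LocalFields.WildQuadraticDatum (trace_bound_pow_of_isRamifiedQuadraticDatum)
open Summit.HodgeConjecture.HodgeConjecture.Cruxes.H413.F0P3cDyRamToricCensusDefs Summit.HodgeConjecture.HodgeConjecture.Cruxes.H413.F0P3cDyRamFourFramePieces
open Summit.HodgeConjecture.HodgeConjecture.Cruxes.H413.F0P3cDyRamFourFrameCensusDefs Summit.HodgeConjecture.HodgeConjecture.Cruxes.H413.F0P3cDyRamStageOneBDefs
open Summit.HodgeConjecture.HodgeConjecture.Cruxes.H413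
open Summit.HodgeConjecture.HodgeConjecture.Cruxes.H413.F0P3cDyRamConeLevelTransport (ncard_glueFibre_eq_natCard_normFibre_of_gen exists_map_eq_glueUnit exists_coneData_of_gen)
open Summit.HodgeConjecture.HodgeConjecture.Cruxes.H413.F0P3cDyRamRowCellFibreTransport (trace_letters)
open Summit.HodgeConjecture.HodgeConjecture.Cruxes.H413.F0P3cDyRamRowCellSphereTransport (ncard_fibre_eq_ncard_fibre_of_sphere)
open Summit.HodgeConjecture.HodgeConjecture.Cruxes.H413.F0P3cDyRamRowCellSocketReads (exists_coord_of_gen)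
open Summit.HodgeConjecture.HodgeConjecture.Cruxes.H413.F0P3cDyRamSphereCellGenerator (cls_iff_cls_and_v_hatKappa_sub_le_of_presentations)
open Summit.HodgeConjecture.HodgeConjecture.Cruxes.H413.F0P3cDyRamAffineLabelDepthZero (v_le_one_of_fixed_of_mul_exp_le)
open Summit.HodgeConjecture.HodgeConjecture.Cruxes.H413.F0P3cDyRamTerminalCellSocketLetters (v_eq_one_of_fixed_fixed socketFibre_eq_sphereFibre sphere_and_flip_of_near
  sphere_and_flip_of_sub_le exists_flip_of_flips)


/-- **(hI) of ★ p863833 for the terminal cell** — the class of `t` and the digit do not depend on the generator (★ p863952 at `τ₀ = |ϖE|^{j+1}`, `η = |ϖE|³`), the digit bound upgraded to `|ϖ|⁴` by the parity of `σ`-fixed valuations. [cite: Kottwitz1986BaseChangeUnits, §1 pp. 240–241] [cite: Serre1979, Ch. III §6 Prop. 12] -/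
theorem cls_iff_and_digit_sub_le_of_gens
    {E M : Type} [Field E] [Valued E ℤᵐ⁰] [CompleteSpace E] [IsDiscreteValuationRing 𝒪[E]] [Finite 𝓀[E]]
    [Field M] [Valued M ℤᵐ⁰] [CompleteSpace M] [IsDiscreteValuationRing 𝒪[M]] [Finite 𝓀[M]]
    {σ : E →+* E} {ϖ : E} {tE : ℕ} {jE : E →+* M} {ρ : M →+* M} {Θ : M →+* M} {α : M} {h : M} {b : ℕ} {j : ℕ} {κ₀ : M} {ξ₀ : M} {δ₂ : ℕ}
    (hdb : 2 ≤ b)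
    (hbj : b < j)
    (hδ₂ : j = b + 2 * δ₂)
    (hD : IsRamifiedQuadraticDatum σ ϖ 2 tE)
    (hσσ : ∀ a, σ (σ a) = a)
    (hvσ : ∀ a, Valued.v (σ a) = Valued.v a)
    (hϖ : Valued.v ϖ = exp (-1 : ℤ))
    (hjv : ∀ a, Valued.v (jE a) ≤ 1 ↔ Valued.v a ≤ 1)
    (hjiso : ∀ a, Valued.v (jE a) = Valued.v a)
    (hjfix : ∀ z : M, ρ z = z ↔ ∃ a, jE a = z)
    (hΘj : ∀ a, Θ (jE a) = jE (σ a))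
    (hρρ : ∀ z, ρ (ρ z) = z)
    (hvρ : ∀ z, Valued.v (ρ z) = Valued.v z)
    (hα : ρ α ≠ α)
    (hα1 : Valued.v α ≤ 1)
    (hΘΘ : ∀ z, Θ (Θ z) = z)
    (hΘρ : ∀ z, Θ (ρ z) = ρ (Θ z))
    (hvΘ : ∀ z, Valued.v (Θ z) = Valued.v z)
    (hΘh : Θ h = h)
    (hb : 1 ≤ b)
    (hjϖ0 : jE ϖ ≠ 0)
    (hvjϖ0 : Valued.v (jE ϖ) ≠ 0)
    (hjϖlt : Valued.v (jE ϖ) < 1)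
    (hjϖle : Valued.v (jE ϖ) ≤ 1)
    (hvϖ0 : Valued.v ϖ ≠ 0)
    (hπσ : σ (ϖ * σ ϖ) = ϖ * σ ϖ)
    (hρϖ : ρ (jE ϖ) = jE ϖ)
    (hcc : jE ϖ ^ j * (α - ρ α) ≠ 0)
    (hclt : Valued.v (jE ϖ ^ j) < 1)
    (hFgap : ∀ z : M, ρ z = z → Θ z = z → Valued.v (jE ϖ) < Valued.v z → Valued.v z ≤ 1 → Valued.v z = 1)
    (hdeep : ∀ {n : ℕ}, 3 ≤ n → ∀ u' : M, ρ u' = u' → Θ u' = u' → Valued.v (u' - 1) ≤ Valued.v (jE ϖ) ^ n → ∃ c : M, ρ c = c ∧ c * Θ c = u')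
    (hΘα : Valued.v (Θ α - α) ≤ Valued.v (jE ϖ))
    (hκ₀ : κ₀ + ρ κ₀ = 1)
    (hΘκ₀ : Θ κ₀ = κ₀)
    (hξ : ρ ξ₀ = -ξ₀)
    (hΘξ : Θ ξ₀ = ξ₀)
    (hξ0 : ξ₀ ≠ 0)
    (hξpos : (0 : ℤᵐ⁰) < Valued.v ξ₀)
    (hξv : Valued.v ξ₀ = Valued.v (jE ϖ) ^ (-(2 * (δ₂ : ℤ))))
    (hRξ : Valued.v ξ₀ * Valued.v (jE ϖ ^ j * (α - ρ α)) = Valued.v (jE ϖ) ^ b)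
    (hκ₀v : Valued.v κ₀ ≤ Valued.v ξ₀)
    (hRle : Valued.v (jE ϖ) ^ b ≤ Valued.v ξ₀ * Valued.v (jE ϖ ^ j * (α - ρ α))) :
    ∀ (Λ : AddSubgroup M) (x₀ x₀' : M), (x₀ ≠ 0 ∧ (∀ x, x ∈ Λ ↔ ∃ ζ, IsOrd ρ α (jE ϖ ^ j) ζ ∧ x = x₀ * ζ) ∧ IsOrd ρ α (jE ϖ ^ j) (dualGen ρ Θ α (jE ϖ ^ j) h x₀) ∧ ¬ IsOrd ρ α (jE ϖ ^ j) (dualGen ρ Θ α (jE ϖ ^ j) h x₀ / jE ϖ) ∧ Valued.v (dualGen ρ Θ α (jE ϖ ^ j) h x₀) = Valued.v (jE ϖ) ^ b) → (x₀' ≠ 0 ∧ (∀ x, x ∈ Λ ↔ ∃ ζ, IsOrd ρ α (jE ϖ ^ j) ζ ∧ x = x₀' * ζ) ∧ IsOrd ρ α (jE ϖ ^ j) (dualGen ρ Θ α (jE ϖ ^ j) h x₀') ∧ ¬ IsOrd ρ α (jE ϖ ^ j) (dualGen ρ Θ α (jE ϖ ^ j) h x₀' / jE ϖ) ∧ Valued.v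 (dualGen ρ Θ α (jE ϖ ^ j) h x₀') = Valued.v (jE ϖ) ^ b) →
      (((∃ e : M, ρ e = e ∧ e * Θ e = (h * (x₀ * Θ x₀)) + ρ (h * (x₀ * Θ x₀)))) ↔ ((∃ e : M, ρ e = e ∧ e * Θ e = (h * (x₀' * Θ x₀')) + ρ (h * (x₀' * Θ x₀'))))) ∧ Valued.v ((((ρ (h * (x₀' * Θ x₀')) / ((h * (x₀' * Θ x₀')) + ρ (h * (x₀' * Θ x₀')))) - κ₀) / ξ₀) - (((ρ (h * (x₀ * Θ x₀)) / ((h * (x₀ * Θ x₀)) + ρ (h * (x₀ * Θ x₀)))) - κ₀) / ξ₀)) ≤ Valued.v ϖ ^ (2 * 2) := by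
  have htrE := trace_bound_pow_of_isRamifiedQuadraticDatum hD
  rintro Λ x₀ x₀' ⟨hx₀, hΛx, hyO, hyp, hylev⟩ ⟨hx₀', hΛx', hyO', hyp', hylev'⟩
  obtain ⟨-, -, ht1⟩ := trace_letters (α := α) hρρ hΘΘ hΘρ hΘh hρϖ hjϖ0 hjϖle hb hcc hFgap hyO hyp hylev
  -- `|κ̂(x₀)| = |ξ₀|`
  have hY : dualGen ρ Θ α (jE ϖ ^ j) h x₀ = (h * (x₀ * Θ x₀)) * (jE ϖ ^ j * (α - ρ α)) := by rw [dualGen_def]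
  have hccpos : (0 : ℤᵐ⁰) < Valued.v (jE ϖ ^ j * (α - ρ α)) := zero_lt_iff.2 ((Valuation.ne_zero_iff _).2 hcc)
  have hu₀v : Valued.v (h * (x₀ * Θ x₀)) = Valued.v ξ₀ := by
    have h1 : Valued.v (h * (x₀ * Θ x₀)) * Valued.v (jE ϖ ^ j * (α - ρ α)) = Valued.v ξ₀ * Valued.v (jE ϖ ^ j * (α - ρ α)) := by
      rw [← Valuation.map_mul, ← hY, hylev, hRξ]
    exact mul_right_cancel₀ (ne_of_gt hccpos) h1
  have hκv : Valued.v (ρ (h * (x₀ * Θ x₀)) / ((h * (x₀ * Θ x₀)) + ρ (h * (x₀ * Θ x₀)))) = Valued.v ξ₀ := by rw [map_div₀, hvρ, ht1, div_one, hu₀v]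
  have hmain := cls_iff_cls_and_v_hatKappa_sub_le_of_presentations hρρ hvρ hα hα1 hΘΘ hΘρ hvΘ σ hσσ hvσ jE hjiso hΘj hjfix htrE hclt
    (τ₀ := Valued.v (jE ϖ) ^ (j + 1)) (η := Valued.v (jE ϖ) ^ 3)
    (by rw [Valuation.map_pow, ← pow_add, add_comm]) (by
      rw [Valuation.map_pow, pow_succ]; exact mul_le_mul' le_rfl hΘα) (by
      rw [Valuation.map_pow, ← pow_add]; exact pow_le_pow_right_of_le_one' hjϖle (by omega))
    (pow_lt_one₀ zero_le hjϖlt (by norm_num)) (hdeep le_rfl) hΘh hx₀ hΛx hΛx' ht1 (by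
      rw [hκv, hξv, ← zpow_natCast, ← zpow_add₀ hvjϖ0, ← zpow_natCast]
      refine zpow_le_zpow_right_of_le_one₀ (zero_lt_iff.2 hvjϖ0) hjϖle ?_
      push_cast; omega)
  refine ⟨hmain.1, ?_⟩
  -- the digit bound `≤ |κ̂|²·τ₀ ∕ |ξ₀| = |ϖE|^{b+1} ≤ |ϖE|³`, upgraded to `|ϖ|⁴` by parity
  obtain ⟨Ve, hVe, hσVe, -⟩ := exists_coord_of_gen hD jE hjv hjfix hΘj hρρ hvρ hΘΘ hΘρ hΘh hb hcc hFgap hκ₀ hΘκ₀ hξ hΘξ hξ0 hκ₀v hRle Λ x₀ ⟨hx₀, hΛx, hyO, hyp, hylev⟩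
  obtain ⟨Ve', hVe', hσVe', -⟩ := exists_coord_of_gen hD jE hjv hjfix hΘj hρρ hvρ hΘΘ hΘρ hΘh hb hcc hFgap hκ₀ hΘκ₀ hξ hΘξ hξ0 hκ₀v hRle Λ x₀' ⟨hx₀', hΛx', hyO', hyp', hylev'⟩
  have hdiff : (((ρ (h * (x₀' * Θ x₀')) / ((h * (x₀' * Θ x₀')) + ρ (h * (x₀' * Θ x₀')))) - κ₀) / ξ₀) - (((ρ (h * (x₀ * Θ x₀)) / ((h * (x₀ * Θ x₀)) + ρ (h * (x₀ * Θ x₀)))) - κ₀) / ξ₀) = ((ρ (h * (x₀' * Θ x₀')) / ((h * (x₀' * Θ x₀')) + ρ (h * (x₀' * Θ x₀')))) - (ρ (h * (x₀ * Θ x₀)) / ((h * (x₀ * Θ x₀)) + ρ (h * (x₀ * Θ x₀))))) / ξ₀ := by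
    rw [← sub_div]; congr 1; ring
  have h3 : Valued.v ((((ρ (h * (x₀' * Θ x₀')) / ((h * (x₀' * Θ x₀')) + ρ (h * (x₀' * Θ x₀')))) - κ₀) / ξ₀) - (((ρ (h * (x₀ * Θ x₀)) / ((h * (x₀ * Θ x₀)) + ρ (h * (x₀ * Θ x₀)))) - κ₀) / ξ₀)) ≤ Valued.v (jE ϖ) ^ 3 := by
    rw [hdiff, map_div₀, div_le_iff₀ hξpos]
    refine hmain.2.trans ?_
    rw [hκv, hξv, ← zpow_natCast, ← zpow_natCast, ← zpow_add₀ hvjϖ0, ← zpow_add₀ hvjϖ0, ← zpow_add₀ hvjϖ0]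
    refine zpow_le_zpow_right_of_le_one₀ (zero_lt_iff.2 hvjϖ0) hjϖle ?_
    push_cast; omega
  -- parity: the difference is `jE` of a `σ`-fixed element
  rw [← hVe, ← hVe', ← map_sub] at h3 ⊢
  simp only [hjiso] at h3 ⊢
  have hπ2 : Valued.v ((ϖ * σ ϖ) ^ 2) = Valued.v ϖ ^ 4 := by
    rw [Valuation.map_pow, Valuation.map_mul, hvσ, ← pow_two, ← pow_mul]
  have hπ2pos : (0 : ℤᵐ⁰) < Valued.v ((ϖ * σ ϖ) ^ 2) := by rw [hπ2]; exact pow_pos (zero_lt_iff.2 hvϖ0) _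
  have hy : Valued.v ((Ve' - Ve) / (ϖ * σ ϖ) ^ 2) * exp (-1 : ℤ) ≤ 1 := by
    rw [map_div₀, hπ2, ← hϖ, div_mul_eq_mul_div, div_le_one₀ (pow_pos (zero_lt_iff.2 hvϖ0) _)]
    calc Valued.v (Ve' - Ve) * Valued.v ϖ ≤ Valued.v ϖ ^ 3 * Valued.v ϖ := mul_le_mul' h3 le_rfl
      _ = Valued.v ϖ ^ 4 := (pow_succ _ 3).symm
  have h1 := v_le_one_of_fixed_of_mul_exp_le hD (by rw [map_div₀, map_sub, hσVe', hσVe, map_pow, hπσ]) hy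
  rw [map_div₀, div_le_one₀ hπ2pos, hπ2] at h1
  calc Valued.v (Ve' - Ve) ≤ Valued.v ϖ ^ 4 := h1
    _ = Valued.v ϖ ^ (2 * 2) := by norm_num

/-- **(hF) of ★ p863833 for the terminal cell** — fibres over two LITERAL digits are equinumerous (★ T-b5b §1, §4 + LH4-p16 (g2)'s ★ `ncard_fibre_eq_ncard_fibre_of_sphere`). [cite: Kottwitz1986BaseChangeUnits, §1 pp. 240–241] [cite: Flicker1998UnitaryFL, Prop. 7 p. 84] -/
theorem ncard_fibre_eq_of_lits
    {E M : Type} [Field E] [Valued E ℤᵐ⁰] [CompleteSpace E] [IsDiscreteValuationRing 𝒪[E]] [Finite 𝓀[E]]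
    [Field M] [Valued M ℤᵐ⁰] [CompleteSpace M] [IsDiscreteValuationRing 𝒪[M]] [Finite 𝓀[M]]
    {σ : E →+* E} {ϖ : E} {jE : E →+* M} {ρ : M →+* M} {Θ : M →+* M} {α : M} {lam : M} {u : GL (Fin 1) E} {hW : E} {h : M} {b : ℕ} {j : ℕ} {κ₀ : M} {ξ₀ : M} {Rd : Finset E}
    (hjiso : ∀ a, Valued.v (jE a) = Valued.v a)
    (hρj : ∀ a, ρ (jE a) = jE a)
    (hΘj : ∀ a, Θ (jE a) = jE (σ a))
    (hρρ : ∀ z, ρ (ρ z) = z)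
    (hvρ : ∀ z, Valued.v (ρ z) = Valued.v z)
    (hΘΘ : ∀ z, Θ (Θ z) = z)
    (hΘρ : ∀ z, Θ (ρ z) = ρ (Θ z))
    (hΘh : Θ h = h)
    (hh : h ≠ 0)
    (hb : 1 ≤ b)
    (hfin : (levelSet ρ Θ α (jE ϖ) h j b).Finite)
    (hϖlt : Valued.v ϖ < 1)
    (hjϖ0 : jE ϖ ≠ 0)
    (hjϖlt : Valued.v (jE ϖ) < 1)
    (hjϖle : Valued.v (jE ϖ) ≤ 1)
    (hρϖ : ρ (jE ϖ) = jE ϖ)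
    (hcc : jE ϖ ^ j * (α - ρ α) ≠ 0)
    (hFgap : ∀ z : M, ρ z = z → Θ z = z → Valued.v (jE ϖ) < Valued.v z → Valued.v z ≤ 1 → Valued.v z = 1)
    (hFN : ∀ f' : M, ρ f' = f' → Θ f' = f' → Valued.v f' = 1 → ∃ z : M, z * Θ z = f')
    (hdeep : ∀ {n : ℕ}, 3 ≤ n → ∀ u' : M, ρ u' = u' → Θ u' = u' → Valued.v (u' - 1) ≤ Valued.v (jE ϖ) ^ n → ∃ c : M, ρ c = c ∧ c * Θ c = u')
    (hκ₀ : κ₀ + ρ κ₀ = 1)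
    (hΘκ₀ : Θ κ₀ = κ₀)
    (hξ : ρ ξ₀ = -ξ₀)
    (hΘξ : Θ ξ₀ = ξ₀)
    (hξ0 : ξ₀ ≠ 0)
    (hξpos : (0 : ℤᵐ⁰) < Valued.v ξ₀)
    (hRξ : Valued.v ξ₀ * Valued.v (jE ϖ ^ j * (α - ρ α)) = Valued.v (jE ϖ) ^ b)
    (hRd1 : ∀ V ∈ Rd, σ V = V ∧ Valued.v V ≤ 1)
    (hr4 : Valued.v ϖ ^ 4 = Valued.v (jE ϖ) ^ 4)
    (hμsq : Valued.v (lam - jE ((u : Matrix (Fin 1) (Fin 1) E) 0 0)) ≤ (Valued.v (jE ϖ) ^ b) ^ 2)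
    (hdepG : ∀ (Λ : AddSubgroup M) (x₀ : M), (x₀ ≠ 0 ∧ (∀ x, x ∈ Λ ↔ ∃ ζ, IsOrd ρ α (jE ϖ ^ j) ζ ∧ x = x₀ * ζ) ∧ IsOrd ρ α (jE ϖ ^ j) (dualGen ρ Θ α (jE ϖ ^ j) h x₀) ∧ ¬ IsOrd ρ α (jE ϖ ^ j) (dualGen ρ Θ α (jE ϖ ^ j) h x₀ / jE ϖ) ∧ Valued.v (dualGen ρ Θ α (jE ϖ ^ j) h x₀) = Valued.v (jE ϖ) ^ b) →
      Λ ∈ levelSetDep ρ Θ α (jE ϖ) h j b (lam - jE ((u : Matrix (Fin 1) (Fin 1) E) 0 0)) ∧ IsOrd ρ α (jE ϖ ^ j) ((lam - jE ((u : Matrix (Fin 1) (Fin 1) E) 0 0)) / dualGen ρ Θ α (jE ϖ ^ j) h x₀)) :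
    ∀ y ∈ Rd.filter (fun V => (Valued.v (κ₀ + jE V * ξ₀) * Valued.v (jE ϖ ^ j * (α - ρ α)) = Valued.v (jE ϖ) ^ b ∧ ∃ (Λ : AddSubgroup M) (x₀ : M), (x₀ ≠ 0 ∧ (∀ x, x ∈ Λ ↔ ∃ ζ, IsOrd ρ α (jE ϖ ^ j) ζ ∧ x = x₀ * ζ) ∧ IsOrd ρ α (jE ϖ ^ j) (dualGen ρ Θ α (jE ϖ ^ j) h x₀) ∧ ¬ IsOrd ρ α (jE ϖ ^ j) (dualGen ρ Θ α (jE ϖ ^ j) h x₀ / jE ϖ) ∧ Valued.v (dualGen ρ Θ α (jE ϖ ^ j) h x₀) = Valued.v (jE ϖ) ^ b) ∧ ∃ z : M, z * Θ z = ρ (κ₀ + jE V * ξ₀) / ρ (ρ (h * (x₀ * Θ x₀)) / ((h * (x₀ * Θ x₀)) + ρ (h * (x₀ * Θ x₀)))))), ∀ y' ∈ Rd.filter (fun V => (Valued.v (κ₀ + jE V * ξ₀) * Valued.v (jE ϖ ^ j * (α - ρ α)) = Valued.v (jE ϖ) ^ b ∧ ∃ (Λ : AddSubgroup M) (x₀ :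 M), (x₀ ≠ 0 ∧ (∀ x, x ∈ Λ ↔ ∃ ζ, IsOrd ρ α (jE ϖ ^ j) ζ ∧ x = x₀ * ζ) ∧ IsOrd ρ α (jE ϖ ^ j) (dualGen ρ Θ α (jE ϖ ^ j) h x₀) ∧ ¬ IsOrd ρ α (jE ϖ ^ j) (dualGen ρ Θ α (jE ϖ ^ j) h x₀ / jE ϖ) ∧ Valued.v (dualGen ρ Θ α (jE ϖ ^ j) h x₀) = Valued.v (jE ϖ) ^ b) ∧ ∃ z : M, z * Θ z = ρ (κ₀ + jE V * ξ₀) / ρ (ρ (h * (x₀ * Θ x₀)) / ((h * (x₀ * Θ x₀)) + ρ (h * (x₀ * Θ x₀)))))),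
      {Λ : AddSubgroup M | ∃ x₀, (x₀ ≠ 0 ∧ (∀ x, x ∈ Λ ↔ ∃ ζ, IsOrd ρ α (jE ϖ ^ j) ζ ∧ x = x₀ * ζ) ∧ IsOrd ρ α (jE ϖ ^ j) (dualGen ρ Θ α (jE ϖ ^ j) h x₀) ∧ ¬ IsOrd ρ α (jE ϖ ^ j) (dualGen ρ Θ α (jE ϖ ^ j) h x₀ / jE ϖ) ∧ Valued.v (dualGen ρ Θ α (jE ϖ ^ j) h x₀) = Valued.v (jE ϖ) ^ b) ∧ ((∃ e : M, ρ e = e ∧ e * Θ e = (h * (x₀ * Θ x₀)) + ρ (h * (x₀ * Θ x₀))) ↔ (∃ e : M, ρ e = e ∧ e * Θ e = -(h * ρ h * ((α - ρ α) * Θ (α - ρ α)) * jE hW))) ∧ Valued.v ((((ρ (h * (x₀ * Θ x₀)) / ((h * (x₀ * Θ x₀)) + ρ (h * (x₀ * Θ x₀)))) - κ₀) / ξ₀) - jE y) ≤ Valued.v ϖ ^ 4}.ncard =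
      {Λ : AddSubgroup M | ∃ x₀, (x₀ ≠ 0 ∧ (∀ x, x ∈ Λ ↔ ∃ ζ, IsOrd ρ α (jE ϖ ^ j) ζ ∧ x = x₀ * ζ) ∧ IsOrd ρ α (jE ϖ ^ j) (dualGen ρ Θ α (jE ϖ ^ j) h x₀) ∧ ¬ IsOrd ρ α (jE ϖ ^ j) (dualGen ρ Θ α (jE ϖ ^ j) h x₀ / jE ϖ) ∧ Valued.v (dualGen ρ Θ α (jE ϖ ^ j) h x₀) = Valued.v (jE ϖ) ^ b) ∧ ((∃ e : M, ρ e = e ∧ e * Θ e = (h * (x₀ * Θ x₀)) + ρ (h * (x₀ * Θ x₀))) ↔ (∃ e : M, ρ e = e ∧ e * Θ e = -(h * ρ h * ((α - ρ α) * Θ (α - ρ α)) * jE hW))) ∧ Valued.v ((((ρ (h * (x₀ * Θ x₀)) / ((h * (x₀ * Θ x₀)) + ρ (h * (x₀ * Θ x₀)))) - κ₀) / ξ₀) - jE y') ≤ Valued.v ϖ ^ 4}.ncard := by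
  intro y hy y' hy'
  obtain ⟨hyR, hys, Λ₁, x₁, hG₁, z₁, hz₁⟩ := Finset.mem_filter.1 hy
  obtain ⟨hy'R, hy's, Λ₂, x₂, hG₂, z₂, hz₂⟩ := Finset.mem_filter.1 hy'
  have hσy : σ y = y := (hRd1 y hyR).1
  have hσy' : σ y' = y' := (hRd1 y' hy'R).1
  have hy1 : Valued.v y ≤ 1 := (hRd1 y hyR).2
  have hy'1 : Valued.v y' ≤ 1 := (hRd1 y' hy'R).2
  have hdep' : ∀ (Λ : AddSubgroup M) (x₀ : M), (x₀ ≠ 0 ∧ (∀ x, x ∈ Λ ↔ ∃ ζ, IsOrd ρ α (jE ϖ ^ j) ζ ∧ x = x₀ * ζ) ∧ IsOrd ρ α (jE ϖ ^ j) (dualGen ρ Θ α (jE ϖ ^ j) h x₀) ∧ ¬ IsOrd ρ α (jE ϖ ^ j) (dualGen ρ Θ α (jE ϖ ^ j) h x₀ / jE ϖ) ∧ Valued.v (dualGen ρ Θ α (jE ϖ ^ j) h x₀) = Valued.v (jE ϖ) ^ b) → IsOrd ρ α (jE ϖ ^ j) ((lam - jE ((u : Matrix (Fin 1) (Fin 1)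 E) 0 0)) / dualGen ρ Θ α (jE ϖ ^ j) h x₀) :=
    fun Λ x₀ hG => (hdepG Λ x₀ hG).2
  rw [socketFibre_eq_sphereFibre (ρ := ρ) (Θ := Θ) (α := α) jE hξ0 hdep' (fun x₀ => (∃ e : M, ρ e = e ∧ e * Θ e = (h * (x₀ * Θ x₀)) + ρ (h * (x₀ * Θ x₀)))) (∃ e : M, ρ e = e ∧ e * Θ e = -(h * ρ h * ((α - ρ α) * Θ (α - ρ α)) * jE hW)) (Valued.v ϖ ^ 4) y,
    socketFibre_eq_sphereFibre (ρ := ρ) (Θ := Θ) (α := α) jE hξ0 hdep' (fun x₀ => (∃ e : M, ρ e = e ∧ e * Θ e = (h * (x₀ * Θ x₀)) + ρ (h * (x₀ * Θ x₀)))) (∃ e : M, ρ e = e ∧ e * Θ e = -(h * ρ h * ((α - ρ α) * Θ (α - ρ α)) * jE hW)) (Valued.v ϖ ^ 4) y']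
  have hccpos : (0 : ℤᵐ⁰) < Valued.v (jE ϖ ^ j * (α - ρ α)) := zero_lt_iff.2 ((Valuation.ne_zero_iff _).2 hcc)
  have hκyv : Valued.v (κ₀ + jE y * ξ₀) = Valued.v ξ₀ := mul_right_cancel₀ (ne_of_gt hccpos) (by rw [hys, hRξ])
  have hκy'v : Valued.v (κ₀ + jE y' * ξ₀) = Valued.v ξ₀ := mul_right_cancel₀ (ne_of_gt hccpos) (by rw [hy's, hRξ])
  have hκy0 : (κ₀ + jE y * ξ₀) ≠ 0 := fun h0 => by rw [h0, map_zero] at hκyv; exact (ne_of_gt hξpos) hκyv.symm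
  obtain ⟨ε, hε⟩ := exists_flip_of_flips (α := α) hρρ hΘΘ hΘρ hΘh hh hρϖ hjϖ0 hjϖle hb hcc hFgap hFN hG₁.1 hG₁.2.2.1 hG₁.2.2.2.1 hG₁.2.2.2.2
    hG₂.1 hG₂.2.2.1 hG₂.2.2.2.1 hG₂.2.2.2.2 hκy0 hz₁ hz₂
  refine ncard_fibre_eq_ncard_fibre_of_sphere (α := α) (μ := (lam - jE ((u : Matrix (Fin 1) (Fin 1) E) 0 0))) hρρ hvρ hΘΘ hΘρ hΘh hρϖ hjϖ0 hjϖlt hb hcc hμsq hFgap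
    (r₀ := Valued.v (jE ϖ) ^ 4) (hdeep (n := 4) (by norm_num)) ?_ ?_ ?_ ?_ hys (hκy'v.trans hκyv.symm) ?_ ?_ hε (∃ e : M, ρ e = e ∧ e * Θ e = -(h * ρ h * ((α - ρ α) * Θ (α - ρ α)) * jE hW)) hfin
  · rw [map_add, map_mul, hρj, hξ]; linear_combination hκ₀
  · rw [map_add, map_mul, hρj, hξ]; linear_combination hκ₀
  · rw [map_add, map_mul, hΘκ₀, hΘj, hσy, hΘξ]
  · rw [map_add, map_mul, hΘκ₀, hΘj, hσy', hΘξ]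
  · rw [hκyv]
    calc Valued.v ϖ ^ 4 * Valued.v ξ₀ < 1 * Valued.v ξ₀ := mul_lt_mul_of_pos_right (pow_lt_one₀ zero_le hϖlt (by norm_num)) hξpos
      _ = Valued.v ξ₀ := one_mul _
  · rw [hκyv, hr4]
    have e : (κ₀ + jE y' * ξ₀) - (κ₀ + jE y * ξ₀) = jE (y' - y) * ξ₀ := by rw [map_sub]; ring
    rw [e, Valuation.map_mul]
    calc Valued.v (jE (y' - y)) * Valued.v ξ₀ * (Valued.v (jE ϖ) ^ 4 * Valued.v ξ₀)
        ≤ 1 * Valued.v ξ₀ * (Valued.v (jE ϖ) ^ 4 * Valued.v ξ₀) := by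
          refine mul_le_mul' (mul_le_mul' ?_ le_rfl) le_rfl
          rw [hjiso]; exact (Valuation.map_sub _ _ _).trans (max_le hy'1 hy1)
      _ = Valued.v (jE ϖ) ^ 4 * Valued.v ξ₀ ^ 2 := by rw [one_mul, mul_left_comm, ← pow_two]

/-- **EVERY WEIGHTED MEMBER OF THE CELL CARRIES A GLUED SELF-DUAL VERTEX** (★ `exists_coneData_of_gen`, ★ `ncard_glueFibre_eq_natCard_normFibre_of_gen`, the weight letter `hf`). [cite: Jacobowitz1962, §4] [cite: Kottwitz1986BaseChangeUnits, §1 pp. 240–241] -/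
theorem exists_glued_of_weight_ne_zero
    {E M : Type} [Field E] [Valued E ℤᵐ⁰] [CompleteSpace E] [IsDiscreteValuationRing 𝒪[E]] [Finite 𝓀[E]]
    [Field M] [Valued M ℤᵐ⁰] [CompleteSpace M] [IsDiscreteValuationRing 𝒪[M]] [Finite 𝓀[M]]
    {σ : E →+* E} {ϖ : E} {jE : E →+* M} {ρ : M →+* M} {Θ : M →+* M} {α : M} {lam : M} {γ₂ : GL (Fin 2) E} {u : GL (Fin 1) E} {H₂ : Matrix (Fin 2) (Fin 2) E} {hW : E} {φ : (Fin 2 → E) →+ M} {h : M} {f : ℕ → ℕ → AddSubgroup M → ℕ} {b : ℕ} {j : ℕ}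
    (hσσ : ∀ a, σ (σ a) = a)
    (hvσ : ∀ a, Valued.v (σ a) = Valued.v a)
    (hϖ : Valued.v ϖ = exp (-1 : ℤ))
    (hH₂ : IsUnit H₂.det)
    (hH₂σ : (H₂.map σ)ᵀ = H₂)
    (hhW : Valued.v hW = 1)
    (hhWσ : σ hW = hW)
    (hjv : ∀ a, Valued.v (jE a) ≤ 1 ↔ Valued.v a ≤ 1)
    (hjfix : ∀ z : M, ρ z = z ↔ ∃ a, jE a = z)
    (hΘj : ∀ a, Θ (jE a) = jE (σ a))
    (hρρ : ∀ z, ρ (ρ z) = z)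
    (hvρ : ∀ z, Valued.v (ρ z) = Valued.v z)
    (hα : ρ α ≠ α)
    (hα1 : Valued.v α ≤ 1)
    (hint : ∀ z : M, Valued.v z ≤ 1 → Valued.v ((z - ρ z) / (α - ρ α)) ≤ 1)
    (hΘΘ : ∀ z, Θ (Θ z) = z)
    (hΘρ : ∀ z, Θ (ρ z) = ρ (Θ z))
    (hvΘ : ∀ z, Valued.v (Θ z) = Valued.v z)
    (hjpow : ∀ (t : E) (n : ℤ), Valued.v (jE t) = Valued.v (jE ϖ) ^ n ↔ Valued.v t = Valued.v ϖ ^ n)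
    (hϖmax : ∀ t : M, ρ t = t → Valued.v t < 1 → Valued.v t ≤ Valued.v (jE ϖ))
    (hφs : ∀ (c : E) (x : Fin 2 → E), φ (c • x) = jE c * φ x)
    (hφi : Function.Injective φ)
    (hφo : Function.Surjective φ)
    (hφγ : ∀ x, φ ((γ₂ : Matrix (Fin 2) (Fin 2) E).mulVec x) = lam * φ x)
    (hvlam : Valued.v lam = 1)
    (hΘh : Θ h = h)
    (hh : h ≠ 0)
    (hform : ∀ x y, jE (pairing σ H₂ x y) = h * Θ (φ x) * φ y + ρ (h * Θ (φ x) * φ y))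
    (hb : 1 ≤ b)
    (hlamj : IsOrd ρ α (jE ϖ ^ j) lam)
    (hf : ∀ (b j : ℕ) (Λ : AddSubgroup M) (x₀ : M) (r : E), 1 ≤ b → x₀ ≠ 0 → (∀ x, x ∈ Λ ↔ ∃ z, IsOrd ρ α (jE ϖ ^ j) z ∧ x = x₀ * z) →
      IsOrd ρ α (jE ϖ ^ j) (dualGen ρ Θ α (jE ϖ ^ j) h x₀) → ¬ IsOrd ρ α (jE ϖ ^ j) (dualGen ρ Θ α (jE ϖ ^ j) h x₀ / jE ϖ) → Valued.v (dualGen ρ Θ α (jE ϖ ^ j) h x₀) = Valued.v (jE ϖ) ^ b →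
      (∀ b', (∀ x ∈ Λ, Valued.v (h * Θ x * b' + ρ (h * Θ x * b')) ≤ 1) → (lam - jE ((u : Matrix (Fin 1) (Fin 1) E) 0 0)) * b' ∈ Λ) → IsOrd ρ α (jE ϖ ^ j) lam →
      jE r = glueUnit ρ Θ α (jE ϖ ^ j) h (jE ϖ) (jE hW) x₀ b →
      f b j Λ = Nat.card {x : 𝒪[E] ⧸ 𝓂[E] ^ (2 * b) // ∃ u' : 𝒪[E], Ideal.Quotient.mk (𝓂[E] ^ (2 * b)) u' = x ∧ Valued.v ((u' : E) * σ u' - r) ≤ Valued.v (ϖ ^ (2 * b))})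
    (hϖ0 : ϖ ≠ 0)
    (hϖlt : Valued.v ϖ < 1)
    (hdepG : ∀ (Λ : AddSubgroup M) (x₀ : M), (x₀ ≠ 0 ∧ (∀ x, x ∈ Λ ↔ ∃ ζ, IsOrd ρ α (jE ϖ ^ j) ζ ∧ x = x₀ * ζ) ∧ IsOrd ρ α (jE ϖ ^ j) (dualGen ρ Θ α (jE ϖ ^ j) h x₀) ∧ ¬ IsOrd ρ α (jE ϖ ^ j) (dualGen ρ Θ α (jE ϖ ^ j) h x₀ / jE ϖ) ∧ Valued.v (dualGen ρ Θ α (jE ϖ ^ j) h x₀) = Valued.v (jE ϖ) ^ b) →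
      Λ ∈ levelSetDep ρ Θ α (jE ϖ) h j b (lam - jE ((u : Matrix (Fin 1) (Fin 1) E) 0 0)) ∧ IsOrd ρ α (jE ϖ ^ j) ((lam - jE ((u : Matrix (Fin 1) (Fin 1) E) 0 0)) / dualGen ρ Θ α (jE ϖ ^ j) h x₀)) :
    ∀ (Λ : AddSubgroup M) (x₀ : M), (x₀ ≠ 0 ∧ (∀ x, x ∈ Λ ↔ ∃ ζ, IsOrd ρ α (jE ϖ ^ j) ζ ∧ x = x₀ * ζ) ∧ IsOrd ρ α (jE ϖ ^ j) (dualGen ρ Θ α (jE ϖ ^ j) h x₀) ∧ ¬ IsOrd ρ α (jE ϖ ^ j) (dualGen ρ Θ α (jE ϖ ^ j) h x₀ / jE ϖ) ∧ Valued.v (dualGen ρ Θ α (jE ϖ ^ j) h x₀) = Valued.v (jE ϖ) ^ b) → f b j Λ ≠ 0 → ∃ B : Submodule 𝒪[E] (Fin 2 → E), B.toAddSubgroup.map φ = Λ ∧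
      ∃ L₃ : Submodule 𝒪[E] (Fin 3 → E), IsSelfDualLattice σ ϖ (!![H₂ 0 0, 0, H₂ 0 1; 0, hW, 0; H₂ 1 0, 0, H₂ 1 1] : Matrix (Fin 3) (Fin 3) E) L₃ ∧ L₃ ⊓ LinearMap.ker ((LinearMap.proj (1 : Fin 3) : (Fin 3 → E) →ₗ[E] E).restrictScalars 𝒪[E]) = B.map ((Matrix.toLin' (!![1, 0; 0, 0; 0, 1] : Matrix (Fin 3) (Fin 2) E)).restrictScalars 𝒪[E]) ∧ (∀ c : E, (Pi.single 1 c : Fin 3 → E) ∈ L₃ ↔ Valued.v c ≤ Valued.v ϖ ^ b) := by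
  rintro Λ x₀ hG hfne
  obtain ⟨hx₀, hΛx, hyO, hyprim, hylev⟩ := id hG
  have hdepΛ := (hdepG Λ x₀ hG).1.2
  obtain ⟨B, hBΛ, -, -, w₀, -, -, -, -, -⟩ := exists_coneData_of_gen σ hϖ0 hϖlt H₂ jE hρρ hvρ hα hα1 hint hΘΘ hΘρ hvΘ hjv hjfix hjpow hϖmax φ hφs hφi hφo hφγ
    hvlam hΘh hh hform ((u : Matrix (Fin 1) (Fin 1) E) 0 0) hb hx₀ hΛx hyO hyprim hylev hdepΛ hlamj
  subst hBΛ
  obtain ⟨r₁, hr₁⟩ := exists_map_eq_glueUnit (ρ := ρ) (Θ := Θ) (α := α) jE hρρ hΘρ hjfix (jE ϖ ^ j) h x₀ ϖ hW b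
  have hcount := ncard_glueFibre_eq_natCard_normFibre_of_gen σ hσσ hvσ hϖ hH₂ hH₂σ hhW hhWσ jE hρρ hvρ hα hα1 hint hΘΘ hΘρ hvΘ hΘj hjv hjfix hjpow hϖmax φ hφs hφi
    hφo hφγ hvlam hΘh hh hform ((u : Matrix (Fin 1) (Fin 1) E) 0 0) hb hx₀ hΛx hyO hyprim hylev hdepΛ hlamj hr₁
  rw [hf b j _ x₀ r₁ hb hx₀ hΛx hyO hyprim hylev hdepΛ hlamj hr₁, ← hcount] at hfne
  obtain ⟨L₃, hL, hLB, htube⟩ := Set.nonempty_of_ncard_ne_zero hfne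
  exact ⟨_, rfl, L₃, hL, hLB, htube⟩

end Summit.HodgeConjecture.HodgeConjecture.Cruxes.H413.F0P3cDyRamTerminalCellFibres

end
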